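import Summits.AtomisticToContinuum.BoseEinsteinCondensation.Theorems.BECThomsonPrincipleFibreConductanceConditionalDefs
import Summits.AtomisticToContinuum.BoseEinsteinCondensation.Theorems.BECThomsonPrincipleFibreConductanceStubWeightedSobolevPoincare
import Summits.AtomisticToContinuum.BoseEinsteinCondensation.Theorems.BECThomsonPrincipleFibreConductanceStubLocalChargeSq
import Summits.AtomisticToContinuum.BoseEinsteinCondensation.Theorems.BECThomsonPrincipleFibreConductanceStubBottomMode
import Summits.AtomisticToContinuum.BoseEinsteinCondensation.Theorems.BECThomsonPrincipleFibreConductanceStubLocalToGlobal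
import Summits.AtomisticToContinuum.BoseEinsteinCondensation.Theorems.BECThomsonPrincipleFibreConductanceStubMomentOfCDM
import HarnessLib

/-!
# Line `conditional-law-poincare` for crux `FibreConductance` (stmt-AtomisticToContinuum-9480)
# — lead's reshaped skeleton r4 (seat c2, prover-line-stmt-AtomisticToContinuum-9480-c2-0, 2026-08-16)

**The crux** (`Theses/BECThomsonPrinciple.lean`, `def FibreConductance`): for bounded repulsive
finite-range `v`, every window parameter `M`, every exact zero-free `C¹` minimiser `Φ` on the torus and
every window mode `k = 2πn/L`, `2π‖n‖/L ≤ M√ρ`: ONE flow `J` in the `x₀`-fibre with weak divergence the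
fibre-neutral charge `q = L^{-3/2}(e^{ik·x₀}ψ − βψ²)` and cost `∫|J|²W/ψ² ≤ C L²/‖n‖²`.

**Status r4 (end of cycle 1).** Vocabulary, statements and the sorry-free composition LANDED as
`Theorems/BECThomsonPrincipleFibreConductanceConditionalDefs.lean` (p108230); stubs 1, 2, 3, 4, 7 LANDED
(`weightedSobolevPoincare_cubeSet` p108264, `localChargeSq_le` p108455, `stub_localToGlobal` p116743 +
p117898, `stub_momentOfCDM` p117946 + p115358 + p118818, `bottomMode_neutral` p108117); stubs 5, 6 OPEN
— stub 6 REDUCED to a pure bath moment (`coarseBeatDualBound_of_coarseMoment`, …StubCoarseOneStep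
p118749) and split by bath Hölder into `ConditionalDensityMoments(3)` × the (3/2)-th bath moment of the
flat coarse beat mass (`coarseCellMoment_of_flatMassMoment`, …StubCoarseFlatMass p115359; free-gas
instance `coarseOf_cruxCharge_eq_zero_of_free`, …StubCoarseFreeGas p115366); the bottom modes
`‖n‖_∞ = 1` follow from `ConditionalDensityMoments` ALONE (…FibreConductanceBottomModes) and the whole
crux from `ConditionalDensityMoments ∧ FlatCoarseMass_{3/2}`
(`fibreConductance_of_conditionalDensityMoments_and_flatCoarseMass`, …FibreConductanceReductionCDM).
This file = the two remaining `sorry`s + the discharges of stubs 1, 2, 7 + the closing theorem (stubs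
3, 4 are the tree theorems of the same name).

**The line (planner skeleton `Lines/conditional-law-poincare.lean`, idea `conditional-law-poincare`),
reshaped by the lead into DUAL + SOBOLEV form over the LANDED vocabulary** (`BECThomsonPrincipleDefs`:
`fibreW`, `fibrePsi`, `fibreBeta`, `phase`, `LowDensityWindow`; `…HealingDefs`: `IsTest`, `dualEnergy`,
`HasDualBound`, `ThomsonRealisation`/`stub_thomson` (p103256), `side`, `cubeSet`, `cubeIdx`, `cubeAvg`;
`…CageDefs`: `ConditionalDensityMoments` (gen 1's shared landscape input); cf. `…DualForm`
(`fibreConductance_iff_dual : FibreConductance ↔ FibreDualBound`, p104461) for the equivalence).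

By Thomson duality (`stub_thomson` + `norm_pairing_sq_le`) the crux is the pure inequality
`‖∫_{cellN} q η‖² ≤ (CL²/‖n‖²)·E(η)`, `E(η) = ∫|∇₀η|²ψ²/W`, for `C¹` periodic test functions `η`
(`CruxDualBound`; realisation `fibreConductance_of_cruxDualBound`): no flow is constructed by this line. Tile
each fibre `[0,L)³` by the `ν_n³ = ‖n‖_∞³` WAVELENGTH cubes `Q` of side `ℓ = L/‖n‖_∞` (block count
`waveBlocks n = ‖n‖_∞ − 1` in the `(ν+1)³` convention of `HealingDefs`) and split the charge as the
planner does, `q = q_loc + q_c` with the COARSE charge `q_c = ψ²·c_Q/μ_Q` on `Q ∋ x₀`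
(`c_Q = ∫_Q q dy` the total cube charge, `μ_Q = ∫_Q ψ² dy` the cube mass) and the LOCAL charge
`q_loc = q − q_c = L^{-3/2}(e^{ik·y}ψ − ψ²A_Q/μ_Q)`, `A_Q = ∫_Q e^{ik·z}ψ` (Lebesgue-neutral on every
cube; `β` cancels). Then:

* `stub_localToGlobal` (deterministic, the lead's; GENERIC in a continuous charge `ρ`): for EVERY
  zero-free state, block count `ν` and level `B`, a dual bound `‖∫ρ_cη‖² ≤ B·E(η)` of the coarse part
  gives `‖∫ρη‖² ≤ (2C·sobolevLevelOf ρ + 2B)·E(η)`.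
  Mechanism: `∫qη = ∫q_loc(η − Πη) + ∫q_cη` EXACTLY (`Πη` = flat block average; the cross term
  `∫q_loc·Πη` vanishes fibrewise by cube-neutrality of `q_loc`); on each cube FLAT Cauchy–Schwarz
  `|∫_Q q_loc(η−⨍_Qη)| ≤ ‖q_loc‖_{L²(Q)}‖η − ⨍_Qη‖_{L²(Q)}` and the WEIGHTED SOBOLEV–POINCARÉ bound
  of `stub_weightedSobolevPoincare` (`∫_Q|f−⨍f|² ≤ C(∫_Q|∇f|²ψ²)(∫_Qψ⁻³)^{2/3}` — the tree's
  Poincaré–Sobolev inequality on cubes `GenPoincare.poincare_sobolev_cube`, `L^{6/5} → L²`, plus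
  Hölder), then Cauchy–Schwarz over cubes and over the bath with weights `W`, `1/W` (c1's `high_sq_le`
  pattern). NO local Poincaré constant of the conditional law appears: it is replaced by the explicit
  hole moment `(∫_Qψ⁻³)^{2/3}` — this is how the planner's `stub_localToGlobal` (Lax–Milgram) and the
  Poincaré-constant half of `stub_localPoincareMoment` are discharged at once.
* `stub_momentOfCDM` (deterministic): the bath moment `sobolevLevel = L⁻³∫_{cellN} W Σ_Q U_Q P_Q`
  (`U_Q = ∫_Q|q_loc|²`, `P_Q = (∫_Qψ⁻³)^{2/3}`) is `≤ A L²/‖n‖²` given `stub_localChargeSq`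
  (`U_Q ≤ 2L⁻³(μ_Q + ℓ³∫_Qψ⁴/μ_Q)`, Cauchy–Schwarz on `A_Q`) and gen 1's
  `ConditionalDensityMoments` at `p = 6` (cube averages `m_k = ⨍_Q g^k` of `g = L³ψ²`:
  `U_QP_Q ≤ 2L⁻³ℓ⁵(m₁ + m₂/m₁)m_{-3/2}^{2/3}`, Young + Jensen `≤ Cℓ⁵L⁻³⨍_Q(g⁶ + g⁻⁶ + 2)`, fibre Fubini).
  Free gas: `A_Q = 0` on commensurate cubes, `U_Q = L⁻⁶ℓ³`, `P_Q = L³ℓ²`, `sobolevLevel = ℓ² = L²/‖n‖_∞²`.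
* `stub_conditionalDensityMoments` (OPEN; gen 1's `stub_conditionalDensityMoments` VERBATIM — the
  cage/fluidity half of the crux, k-free, shared by two lines now).
* `stub_coarseBeatDual` (OPEN, HARDEST, the crux's infrared content; only for `‖n‖_∞ ≥ 2`): the coarse
  charge has dual bound `‖∫q_cη‖² ≤ (BL²/‖n‖²)E(η)`. With μ-WEIGHTED block averages `q_c`'s pairing is
  EXACTLY a lattice pairing `Σ_Q c_Q⟨η⟩_{μ,Q}` on the `‖n‖_∞³` torus grid, so the stub is a
  random-conductance lattice `H⁻¹` bound for the cube charges `c_Q` (coarse cages ⇐ Sobolev on double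
  cubes ⇐ CDM; flat beat sum ⇐ `ShellOccupation` + kinetic budget) — `infraredNecessity` (p90785) applies
  to it verbatim at the window top; not attacked by energy here.
* `stub_bottomMode` (deterministic): one cube (`ν = 0`) ⇒ `c_Q = ∫_cell q = L^{-3/2}(β − β∫ψ²) = 0`
  ⇒ `q_c ≡ 0`: at the bottom modes `‖n‖_∞ = 1` the crux is `stub_localToGlobal` +
  `stub_momentOfCDM` + `ConditionalDensityMoments` ALONE.

Composition (sorry-free, §3): `FibreConductance_of wsp lcs lg mc cdm cb bm =
fibreConductance_iff_dual.mpr (fibreDualBound_of (lg wsp) (mc lcs cdm) cb bm)`, constants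
`ρ₀ = min`, `N₀ = max`, `C = 2C_PS·A + 2B`.

**Disproof.lean v7 honoured.** (H1) (`not_fibreConductanceNearMinimiser`, slab cage) binds exactly the
two open stubs: the slab state has `⨍g⁻⁶ ≍ σ⁻¹²` (CDM false) and is where the planner's line failed
too; the four deterministic stubs hold for every zero-free state. §E floor: free gas gives
`sobolevLevel = L²/‖n‖_∞²`, `q_c ≡ 0`, `C = 2C_PS ≥ …` (no sharpness claimed). §Infrared: the reason
`stub_coarseBeatDual` is isolated and vacuous at `‖n‖_∞ = 1` (where `infraredNecessity` is empty).
`hardCore_no_admissible_state`: bounded `v` throughout. Landed `Negative/` lemmas: no stub is an instance.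
-/

noncomputable section

namespace Summit.AtomisticToContinuum.BoseEinsteinCondensation.Cruxes.FibreConductance.ConditionalLawPoincare

open MeasureTheory
open scoped ENNReal
open Literature.MathematicalPhysics.QuantumManyBody.BoseGas
open Summit.AtomisticToContinuum.BoseEinsteinCondensation.Theses.BECThomsonPrinciple (FibreConductance)
open Summit.AtomisticToContinuum.BoseEinsteinCondensation.Cruxes.FibreConductance.ParsevalShellBootstrap
open Summit.AtomisticToContinuum.BoseEinsteinCondensation.Cruxes.FibreConductance.HealingSplitKineticDefect

/-! ## Registered stubs -/

/-- **Stub 1** LANDED (p108264, `…StubWeightedSobolevPoincare`): the weighted Sobolev–Poincaré tool on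
the tiling cubes. [folklore] -/
theorem stub_weightedSobolevPoincare : Goal.stub_weightedSobolevPoincare := weightedSobolevPoincare_cubeSet

/-- **Stub 2** LANDED (p108455, `…StubLocalChargeSq`): the local charge is small in flat `L²`. [folklore] -/
theorem stub_localChargeSq : Goal.stub_localChargeSq := localChargeSq_le

-- Stub 3 `stub_localToGlobal` LANDED: Theorems/BECThomsonPrincipleFibreConductanceStubLocalToGlobal.lean (+ …Helpers).

-- Stub 4 `stub_momentOfCDM` LANDED: Theorems/BECThomsonPrincipleFibreConductanceStubMomentOfCDM.lean (parts …Cube / …Bath).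

/-- **Stub 5** (OPEN; the shared landscape input of gen 1): see
`TaggedPathHarnack.ConditionalDensityMoments`. (Refs: ReattoChester1967.) -/
theorem stub_conditionalDensityMoments : Goal.stub_conditionalDensityMoments := by
  sorry

/-- **Stub 6** (OPEN; HARDEST; the infrared content; only `‖n‖_∞ ≥ 2`): see `CoarseBeatDualBound`.
REDUCED by the lead (cycle 1): `q_c` is fibre-neutral, so at block count `0` it is its own local part and
`hasDualBound_coarseOf_of_neutral` (…StubCoarseOneStep) bounds its dual norm by the CELL-SCALE SOBOLEV
LEVEL of itself; `coarseBeatDualBound_of_coarseMoment : (sobolevLevelOf L 0 Φ q_c ≤ B L²/‖n‖² in the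
window) → CoarseBeatDualBound` — the stub is a PURE BATH MOMENT of the exact ground state
(flat mass `∫_cell|q_c|²` × cell hole factor `(∫_cellψ⁻³)^{2/3}` × `W`). Bath Hölder (3/2, 3)
(`coarseCellMoment_of_flatMassMoment`, …StubCoarseFlatMass) splits it into `ConditionalDensityMoments`
(`p = 3`) × the (3/2)-th bath moment of the flat coarse mass, `E_W[(L³∫_cell|q_c|²)^{3/2}] ≤ K/‖n‖_∞³`,
whose FIRST moment is — up to CDM-controlled landscape factors — the smoothed shell occupation sum
`Σ_{p ≠ −n} n_p(|Φ|)·F_ℓ(k_p + k)` on exactly `ShellOccupation`'s shell `‖p + n‖ ≲ ‖n‖_∞` (bath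
correlations of the fibre Fourier modes are diagonal by translation invariance): ShellOccupation-
equivalent at first moment, a (3/2)-th bath moment on top — the price of separating landscape from
infrared by Hölder rather than by a random-conductance (GKZ) argument. `≡ 0` at `v = 0`
(`coarseOf_cruxCharge_eq_zero_of_free`, …StubCoarseFreeGas: commensurate cubes) and at `‖n‖_∞ = 1`.
Crux-sized at the window top (`infraredNecessity` p90785). A dyadic iteration of the one-step
reduction (scales `ℓ, 2ℓ, …, L`) charges scale-`s` charge fluctuations `s²` instead of `L²`.
(Refs: KennedyLiebShastry1988; GrimmettKestenZhang1993.) -/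
theorem stub_coarseBeatDual : Goal.stub_coarseBeatDual := by
  sorry

/-- **Stub 7** LANDED (p108117, `…StubBottomMode`): one cube carries no coarse charge. [folklore] -/
theorem stub_bottomMode : Goal.stub_bottomMode := bottomMode_neutral

/-! ## The closing theorem -/

/-- The crux modulo the registered stubs still open (becomes the closing proof when they land). -/
theorem fibreConductance_of_registered_stubs : FibreConductance :=
  FibreConductance_of stub_weightedSobolevPoincare stub_localChargeSq stub_localToGlobal
    stub_momentOfCDM stub_conditionalDensityMoments stub_coarseBeatDual stub_bottomMode

end Summit.AtomisticToContinuum.BoseEinsteinCondensation.Cruxes.FibreConductance.ConditionalLawPoincare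

end
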